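import Mathlib.Geometry.Manifold.Instances.Sphere
import Mathlib.Geometry.Manifold.Diffeomorph
import Mathlib.Topology.Homotopy.Basic
import Mathlib.AlgebraicTopology.FundamentalGroupoid.SimplyConnected
import Literature.Topology.FourManifolds.Isotopy
import Literature.Topology.FourManifolds.IntersectionNumbers
import Literature.Topology.FourManifolds.SphereFamilySurgery
import HarnessLib

/-!
# Gabai's light bulb theorem for multiple spheres (Gabai 2020, Theorem 10.1)

Topic `Literature/Topology/FourManifolds`. NAMED FACT (D-0014), no proofs; companion of
`LightBulbTheorem.lean` (Theorem 1.9, the `S² × S²` case).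

D. Gabai, *The 4-dimensional light bulb theorem*, J. Amer. Math. Soc. **33** (2020), 609–652
(arXiv:1705.09989) [Gabai2020]; held text `paper:arxiv-1705.09989`, §10 p. 22, verbatim:

> **Theorem 10.1.** Let `M` be an orientable 4-manifold such that `π₁(M)` has no 2-torsion. Let
> `G₁, ⋯, Gₙ` be pairwise disjoint embedded spheres with trivial normal bundles. Let `R₁, ⋯, Rₙ`
> be pairwise disjoint embedded spheres transverse to the `Gᵢ`'s such that `|Rᵢ ∩ Gⱼ| = δᵢⱼ`. Let
> `S₁, ⋯, Sₙ` be another set of spheres with the same properties and coinciding with the `Rᵢ`'s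
> near the `Gᵢ`'s. If for each `i`, `Rᵢ` is homotopic to `Sᵢ`, then there exists an isotopy of
> `M` fixing a neighborhood of the `Gᵢ`'s pointwise such that for all `j`, `Rⱼ` is taken to `Sⱼ`.

(Definition 2.1, p. 5: "A transverse sphere `G` to the immersed surface `R` is a sphere with
trivial normal bundle that intersects `R` transversely in a single point.")

## The Lean form (closed simply connected case)

Stated over the tree's four-manifold vocabulary, in the shape used by route
`SmoothPoincare4/CommonDualRelay`:
* the ambient manifold is a CLOSED, SIMPLY CONNECTED smooth 4-manifold `N` (`CompactSpace`,
  boundaryless model `𝓡 4`, `SimplyConnectedSpace` — so `π₁ = 1` has no 2-torsion) carrying a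
  smooth orientation `oN` (`SmoothOrientation`, so `N` is orientable): a SPECIALISATION of the
  printed hypotheses (Gabai allows non-compact `M` and any `π₁` without 2-torsion);
* `σ` (Gabai's `G`), `A` (his `R`) and `C` (his `S`) are framed families of pairwise disjoint
  embedded 2-spheres indexed by `Fin k` (`FramedSphereFamily (𝓡 4) N (Fin k) 2 2`: open embeddings
  of `S² × ℝ²` with pairwise disjoint images — in particular every sphere of a family is embedded
  with TRIVIAL normal bundle, as required of the `Gᵢ`; for `Rᵢ, Sᵢ` the framing is extra data the
  statement does not use);
* "transverse to the `Gᵢ`'s with `|Rᵢ ∩ Gⱼ| = δᵢⱼ`" is `IsGeometricallyDual … σ.sphere A.sphere`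
  (Matveyev's predicate, `IntersectionNumbers.lean`: all pairs transverse, algebraic intersection
  numbers `δᵢⱼ`, and exactly one double point for `i = j`, none for `i ≠ j`), likewise for `C`;
* "coinciding with the `Rᵢ`'s near the `Gᵢ`'s": some open `U ⊇ σ.cores` with
  `Aᵢ(S²) ∩ U = Cᵢ(S²) ∩ U` for every `i`;
* "`Rᵢ` is homotopic to `Sᵢ`": the parametrised spheres are homotopic as continuous maps
  `S² → N` (`ContinuousMap.Homotopic`);
* conclusion: an ambient isotopy `F` of `N` (tree structure `AmbientIsotopy`, `Isotopy.lean`: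
  jointly smooth, every stage a diffeomorphism, `F 0 = id`) whose time-one map carries the SET
  `Aⱼ(S²)` onto `Cⱼ(S²)` for every `j`, and which fixes some neighbourhood of `σ.cores` pointwise
  at all times.

Consumer: route `SmoothPoincare4/CommonDualRelay`, item
`Summit.SmoothPoincare4.SmoothPoincare4.Theses.CommonDualRelay.GabaiSystemsLightBulb`
(stmt-SmoothPoincare4-15792), which keeps only the time-one diffeomorphism (corollary
`Gabai2020_thm_10_1_systems.endDiffeo` below) and DROPS the hypothesis "coinciding near the
`Gᵢ`'s" — Gabai obtains it by "a preliminary isotopy" (p. 22, proof of Step 1, first sentence),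
a step that is NOT part of the printed statement and is not asserted here: the item is the fact
composed with that preliminary isotopy.

## References

* D. Gabai, *The 4-dimensional light bulb theorem*, JAMS 33 (2020), Thm. 10.1 (p. 22 of
  arXiv:1705.09989), Def. 2.1 (p. 5). [Gabai2020]
* R. Schneiderman, P. Teichner, *Homotopy versus isotopy: spheres with duals in 4-manifolds*,
  Duke Math. J. 171 (2022) (the 2-torsion hypothesis via the Freedman–Quinn invariant; not used).
-/

noncomputable section

open scoped Manifold ContDiff
open Set Function

namespace Literature.Topology.FourManifolds

/-- The round 2-sphere `S² ⊂ ℝ³` with Mathlib's smooth structure (model `𝓡 2`). -/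
local notation "𝕊²" => (Metric.sphere (0 : EuclideanSpace ℝ (Fin 3)) 1)

/-- **Gabai 2020, Theorem 10.1 (light bulb theorem for multiple spheres), closed simply connected
case, set form.** "Let `M` be an orientable 4-manifold such that `π₁(M)` has no 2-torsion. Let
`G₁, ⋯, Gₙ` be pairwise disjoint embedded spheres with trivial normal bundles. Let `R₁, ⋯, Rₙ` be
pairwise disjoint embedded spheres transverse to the `Gᵢ`'s such that `|Rᵢ ∩ Gⱼ| = δᵢⱼ`. Let
`S₁, ⋯, Sₙ` be another set of spheres with the same properties and coinciding with the `Rᵢ`'s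
near the `Gᵢ`'s. If for each `i`, `Rᵢ` is homotopic to `Sᵢ`, then there exists an isotopy of `M`
fixing a neighborhood of the `Gᵢ`'s pointwise such that for all `j`, `Rⱼ` is taken to `Sⱼ`."
Here `M = N` is closed, simply connected and smoothly oriented (special case of the print),
`G = σ`, `R = A`, `S = C` are framed families of disjoint embedded 2-spheres, duality is
`IsGeometricallyDual` (transverse, `δᵢⱼ` double points), coincidence near `σ` is literal on an
open `U ⊇ σ.cores`, and the isotopy is an `AmbientIsotopy` with `F 1 '' Aⱼ(S²) = Cⱼ(S²)` fixing an
open `V ⊇ σ.cores` pointwise at all times. A named fact (D-0014), NOT asserted; users take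
`(h : Gabai2020_thm_10_1_systems)`. Grounds
`Summit.SmoothPoincare4.SmoothPoincare4.Theses.CommonDualRelay.GabaiSystemsLightBulb` up to
Gabai's "preliminary isotopy" making `Cᵢ` agree with `Aᵢ` near `σᵢ` (p. 22, not in the printed
statement). [cite: Gabai2020, Thm. 10.1 (p. 22) and Def. 2.1 (p. 5)] -/
def Gabai2020_thm_10_1_systems : Prop :=
  ∀ (N : Type) [TopologicalSpace N] [T2Space N] [SecondCountableTopology N]
    [ChartedSpace (EuclideanSpace ℝ (Fin 4)) N] [IsManifold (𝓡 4) ∞ N] [CompactSpace N]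
    [SimplyConnectedSpace N] (oN : SmoothOrientation (𝓡 4) N) (oS : SmoothOrientation (𝓡 2) 𝕊²)
    (k : ℕ) (A C σ : FramedSphereFamily (𝓡 4) N (Fin k) 2 2),
    IsGeometricallyDual (𝓡 2) (𝓡 2) (𝓡 4) two_add_two_eq_four oS oS oN σ.sphere A.sphere →
    IsGeometricallyDual (𝓡 2) (𝓡 2) (𝓡 4) two_add_two_eq_four oS oS oN σ.sphere C.sphere →
    (∀ i, (⟨A.sphere i, A.continuous_sphere i⟩ : C(𝕊², N)).Homotopic
      ⟨C.sphere i, C.continuous_sphere i⟩) →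
    (∃ U : Set N, IsOpen U ∧ σ.cores ⊆ U ∧ ∀ i, range (A.sphere i) ∩ U = range (C.sphere i) ∩ U) →
    ∃ F : AmbientIsotopy (𝓡 4) N,
      (∀ i, F.toFun 1 '' range (A.sphere i) = range (C.sphere i)) ∧
      ∃ V : Set N, IsOpen V ∧ σ.cores ⊆ V ∧ ∀ (t : ℝ), ∀ x ∈ V, F.toFun t x = x

/-- **Time-one form of Gabai's Theorem 10.1** (corollary of the named fact
`Gabai2020_thm_10_1_systems`, in the shape of the route item
`Summit.SmoothPoincare4.SmoothPoincare4.Theses.CommonDualRelay.GabaiSystemsLightBulb` with the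
printed coincidence hypothesis kept): under the hypotheses of the fact, the time-one stage of the
isotopy is a self-diffeomorphism `φ` of `N` with `φ(Aᵢ(S²)) = Cᵢ(S²)` for every `i`, fixing
`σ.cores` pointwise. [cite: Gabai2020, Thm. 10.1 (p. 22)] -/
theorem Gabai2020_thm_10_1_systems.endDiffeo (h : Gabai2020_thm_10_1_systems) :
    ∀ (N : Type) [TopologicalSpace N] [T2Space N] [SecondCountableTopology N]
      [ChartedSpace (EuclideanSpace ℝ (Fin 4)) N] [IsManifold (𝓡 4) ∞ N] [CompactSpace N]
      [SimplyConnectedSpace N] (oN : SmoothOrientation (𝓡 4) N)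
      (oS : SmoothOrientation (𝓡 2) 𝕊²) (k : ℕ) (A C σ : FramedSphereFamily (𝓡 4) N (Fin k) 2 2),
      IsGeometricallyDual (𝓡 2) (𝓡 2) (𝓡 4) two_add_two_eq_four oS oS oN σ.sphere A.sphere →
      IsGeometricallyDual (𝓡 2) (𝓡 2) (𝓡 4) two_add_two_eq_four oS oS oN σ.sphere C.sphere →
      (∀ i, (⟨A.sphere i, A.continuous_sphere i⟩ : C(𝕊², N)).Homotopic
        ⟨C.sphere i, C.continuous_sphere i⟩) →
      (∃ U : Set N, IsOpen U ∧ σ.cores ⊆ U ∧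
        ∀ i, range (A.sphere i) ∩ U = range (C.sphere i) ∩ U) →
      ∃ φ : N ≃ₘ⟮𝓡 4, 𝓡 4⟯ N,
        (∀ i, range (φ ∘ A.sphere i) = range (C.sphere i)) ∧ ∀ x ∈ σ.cores, φ x = x := by
  intro N _ _ _ _ _ _ _ oN oS k A C σ hA hC hhom hcoin
  obtain ⟨F, hF1, V, -, hσV, hfix⟩ := h N oN oS k A C σ hA hC hhom hcoin
  refine ⟨F.toDiffeomorph 1, fun i => ?_, fun x hx => ?_⟩
  · rw [range_comp, F.coe_toDiffeomorph 1, hF1 i]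
  · rw [F.coe_toDiffeomorph 1]
    exact hfix 1 x (hσV hx)

end Literature.Topology.FourManifolds

end
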